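import Summits.Ventures.DiscreteObjects.Hadamard.Order167InvertingNormalizer668
import Summits.Ventures.DiscreteObjects.Hadamard.Order167InvertingIsInvolution668
import Summits.Ventures.DiscreteObjects.Hadamard.Order167WilliamsonType668

/-!
# H(668): an element of order 167 inverted by a FIXED-POINT-FREE automorphism ⇔ a 4 × 4 circulant array whose blocks are
# PAIRED UNDER TRANSPOSITION (kernel dictionary; the last leaf of the 167-local dictionary)

Framing: lottery ticket; floor = certified bounds/negative ranges.

Cell pub-namedobj (venture DiscreteObjects), target (H), hadamard gen 23; HANDOFF-H-g22 item 3.  Let `σ = (π, κ, d, e)` be a signed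
automorphism of pair order `167` of a hypothetical H(668) and `ρ' = (π', κ', d', e')` a signed automorphism INVERTING it
(`π'π = π^μ π'`, `κ'κ = κ^μ κ'`, `μ ≡ 166 (mod 167)`) WITHOUT a fixed row.  By gen 22 (`Order167InvertingIsInvolution668`): `ρ'` is a
pair-involution, moves EVERY row and column out of its `σ`-orbit and is nega (`d'(π' i) = −d'(i)`); so it pairs the four row orbits
and the four column orbits.  Gen 20 (`Order167InvertingNormalizer668`) treated the complementary case (all orbits preserved ⇔
sixteen SYMMETRIC circulant blocks); here:
* **`exists_pairedCirculantArray_of_inverting_fpf`**: there are fixed-point-free involutions `τ, τ'` of `Fin 4` (the orbit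
  pairings), signs `ε, ε' : Fin 4 → {±1}` with `ε ∘ τ = −ε`, `ε' ∘ τ' = −ε'`, and sixteen `±1` sequences `x p q` on `ℤ/167` with
  **`x (τ p) (τ' q) (−r) = ε p · ε' q · x p q r`** (the block `(τ p, τ' q)` is `±` the TRANSPOSE of the block `(p, q)`: eight free
  circulants) whose array `M (p,s) (q,t) = x p q (t − s)` is a Hadamard matrix of order `668`.  [Re-sign `σ` to a permutation pair;
  `ρ'` acts on `H'` with signs `d₁, e₁` constant along `σ`-orbits (`signs_const_of_normalizing`); choose the row transversal so that
  `π' b_p = b_{τ p}` EXACTLY (take `b_{τ p} := π' b_p` on one member of each pair, `π'² = 1`), likewise for columns; then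
  `H'(π' b_p, κ'κ^r c_q) = d₁(b_p) e₁(c_q) H'(b_p, κ^r c_q)` reads `x_{τp,τ'q}(−r) = ε_p ε'_q x_{pq}(r)`, and `d₁(π' i) = −d₁(i)`.]
* **`pairedCirculantArray_inverting_aut`** (converse): such an array carries the block shift `σ₀` (gen 19) and
  `ρ₀ : (p, s) ↦ (τ p, −s)` / `(q, t) ↦ (τ' q, −t)` with signs `ε, ε'` — a signed automorphism inverting `σ₀` and moving every row.
* **`hadamard668_aut167_inverting_fpf_iff_pairedCirculantArray`**: the `iff` (every `μ ≡ 166`).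
With gen 19 (sixteen circulants), gen 20 (block-preserving inversion ⇔ sixteen symmetric circulants), gen 21 (index 4 ⇔
Williamson-type), gen 22 (`|N̄| = 8` ⇔ classical Williamson; fixed-point-free inverting COSET with a centralising involution ⇔ Ito)
and gen 23 (order 334 ⇔ Ito; order 334 + row-fixing inversion ⇔ Williamson sequences) every symmetry type of an element of order
167 of a hypothetical H(668) now has a typed array on the right-hand side.  STRUCTURE / DICTIONARY of a hypothetical object; no
order excluded; H(668) untouched.  Ours; no `sorry`, no definitions, default heartbeats.
-/

namespace Summit.Ventures.DiscreteObjects.Hadamard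

open Finset BigOperators Matrix

open Literature.Combinatorics.Designs.GoethalsSeidel (IsHadamardMatrix)

variable {ι : Type*} [Fintype ι] [DecidableEq ι]

section main
variable {H : Matrix ι ι ℤ} (hH : IsHadamardMatrix H) (hι : Fintype.card ι = 668)
  {π κ π' κ' : Equiv.Perm ι} {d e d' e' : ι → ℤ} (haut : IsSignedAut H π κ d e)
  (hπ : π ^ 167 = 1) (hκ : κ ^ 167 = 1) (hne : π ≠ 1 ∨ κ ≠ 1)
  (haut' : IsSignedAut H π' κ' d' e') {μ : ℕ} (hnπ : π' * π = π ^ μ * π') (hnκ : κ' * κ = κ ^ μ * κ') (hμ : μ % 167 = 166)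
include hH hι haut hπ hκ hne haut' hnπ hnκ hμ

omit [Fintype ι] hH hι haut hκ hne haut' hnκ hμ in
/-- **pairing of a free transversal by an inverting fixed-point-free involution (rows).**  Given orbit representatives
`u : Fin 4 → ι` whose orbit map `(p, s) ↦ π^s (u p)` is a bijection, an involution `π'` inverting `π` that preserves no orbit
induces a fixed-point-free involution `τ` of `Fin 4` and NEW representatives `b p = π^{m p} (u p)` with `π' (b p) = b (τ p)`. -/
lemma exists_paired_reps (u : Fin 4 → ι) (hbij : Function.Bijective (fun a : Fin 4 × ZMod 167 => (π ^ a.2.val) (u a.1)))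
    (hinv2 : ∀ x, π' (π' x) = x) (hout : ∀ x, π' x ∉ orbFin π 167 x) :
    ∃ (τ : Fin 4 → Fin 4) (b : Fin 4 → ι) (m : Fin 4 → ℕ), (∀ p, τ p ≠ p) ∧ (∀ p, τ (τ p) = p) ∧
      (∀ p, b p = (π ^ m p) (u p)) ∧ ∀ p, π' (b p) = b (τ p) := by
  set E : Fin 4 × ZMod 167 ≃ ι := Equiv.ofBijective _ hbij with hE
  -- orbit index and offset of `π' (u p)`
  set τ : Fin 4 → Fin 4 := fun p => (E.symm (π' (u p))).1 with hτ
  set k : Fin 4 → ZMod 167 := fun p => (E.symm (π' (u p))).2 with hk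
  have hR1 : ∀ p, π' (u p) = (π ^ (k p).val) (u (τ p)) := fun p => by
    have h := Equiv.apply_symm_apply E (π' (u p))
    exact h.symm
  have hτne : ∀ p, τ p ≠ p := fun p h => by
    apply hout (u p)
    rw [hR1 p, h]
    exact pow_apply_mem_orbFin π (by norm_num) hπ (u p) _
  -- `π' (u (τ p))` is back in the orbit of `u p`
  have hback : ∀ p, π' (u (τ p)) = (π ^ (166 * (μ * (k p).val))) (u p) := fun p => by
    have h1 : (π ^ (μ * (k p).val)) (π' (u (τ p))) = u p := by
      rw [← norm_apply_pow hnπ, ← hR1 p, hinv2]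
    calc π' (u (τ p)) = (π ^ (166 * (μ * (k p).val) + μ * (k p).val)) (π' (u (τ p))) := by
          rw [show 166 * (μ * (k p).val) + μ * (k p).val = 167 * (μ * (k p).val) by ring, pow_mul, hπ, one_pow,
            Equiv.Perm.one_apply]
      _ = (π ^ (166 * (μ * (k p).val))) (u p) := by rw [pow_add, Equiv.Perm.mul_apply, h1]
  have hττ : ∀ p, τ (τ p) = p := fun p => by
    show (E.symm (π' (u (τ p)))).1 = p
    have h2 : π' (u (τ p)) = E (p, ((166 * (μ * (k p).val) : ℕ) : ZMod 167)) := by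
      rw [hback p]
      show _ = (π ^ (((166 * (μ * (k p).val) : ℕ) : ZMod 167)).val) (u p)
      rw [ZMod.val_natCast, pow_mod_of_pow_eq_one π hπ]
    rw [h2, Equiv.symm_apply_apply]
  -- base points: `u p` on the member `p < τ p` of each pair, `π' (u (τ p))` on the other
  refine ⟨τ, fun p => if p < τ p then u p else π' (u (τ p)), fun p => if p < τ p then 0 else 166 * (μ * (k p).val), hτne, hττ,
    fun p => ?_, fun p => ?_⟩
  · by_cases hp : p < τ p
    · simp only [if_pos hp, pow_zero, Equiv.Perm.one_apply]
    · simp only [if_neg hp]; exact hback p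
  · by_cases hp : p < τ p
    · have hq : ¬ τ p < τ (τ p) := by rw [hττ]; exact lt_asymm hp
      simp only [if_pos hp, if_neg hq]
      rw [hττ]
    · have hq : τ p < τ (τ p) := by
        rw [hττ]; exact lt_of_le_of_ne (not_lt.mp hp) (hτne p)
      simp only [if_neg hp, if_pos hq, hinv2]

/-- **Fixed-point-free inversion ⇒ a paired circulant array.** -/
theorem exists_pairedCirculantArray_of_inverting_fpf (hfpf : ∀ x, π' x ≠ x) :
    ∃ (τ τ' : Equiv.Perm (Fin 4)) (ε ε' : Fin 4 → ℤ) (x : Fin 4 → Fin 4 → ZMod 167 → ℤ),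
      (∀ p, τ p ≠ p) ∧ (∀ p, τ (τ p) = p) ∧ (∀ q, τ' q ≠ q) ∧ (∀ q, τ' (τ' q) = q) ∧
      (∀ p, ε p = 1 ∨ ε p = -1) ∧ (∀ q, ε' q = 1 ∨ ε' q = -1) ∧ (∀ p, ε (τ p) = -ε p) ∧ (∀ q, ε' (τ' q) = -ε' q) ∧
      (∀ p q r, x (τ p) (τ' q) (-r) = ε p * ε' q * x p q r) ∧
      IsHadamardMatrix (Matrix.of fun (a b : Fin 4 × ZMod 167) => x a.1 b.1 (b.2 - a.2)) := by
  have h167 := hadamard668_fixedRows_167 hH hι π κ d e haut hπ hκ hne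
  have hπfix : ∀ x, π x ≠ x := moved_of_card_fixed_eq_zero π h167.1
  have hκfix : ∀ y, κ y ≠ y := moved_of_card_fixed_eq_zero κ h167.2.1
  have p167 : Nat.Prime 167 := by norm_num
  -- gen 22: ρ' is an involution; no orbit is preserved; nega
  obtain ⟨hp2, hk2⟩ := hadamard668_order167_inverting_sq_eq_one hH hι haut hπ hκ hne haut' hnπ hnκ hμ
  have hππ : ∀ x, π' (π' x) = x := fun x => by
    have h := congrArg (fun ρ : Equiv.Perm ι => ρ x) hp2
    simpa [pow_two, Equiv.Perm.mul_apply] using h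
  have hκκ : ∀ y, κ' (κ' y) = y := fun y => by
    have h := congrArg (fun ρ : Equiv.Perm ι => ρ y) hk2
    simpa [pow_two, Equiv.Perm.mul_apply] using h
  obtain ⟨hrout, hcout, hnegd, hnege⟩ : (∀ x, π' x ∉ orbFin π 167 x) ∧ (∀ y, κ' y ∉ orbFin κ 167 y) ∧
      (∀ i, d' (π' i) = -d' i) ∧ (∀ j, e' (κ' j) = -e' j) := by
    rcases hadamard668_order167_inverting_all_or_none hH hι haut hπ hκ hne haut' hnπ hnκ hμ with
      ⟨-, -, hcard4, -⟩ | ⟨hr, hc, -, -, hd, he⟩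
    · exfalso
      obtain ⟨x₀, hx₀⟩ : (univ.filter fun x => π' x = x).Nonempty := by
        rw [← Finset.card_pos, hcard4]; norm_num
      exact hfpf x₀ (Finset.mem_filter.mp hx₀).2
    · exact ⟨hr, hc, hd, he⟩
  -- re-sign
  obtain ⟨s, t, hs, ht, hH', hinv⟩ := exists_resign_of_odd hH haut (by decide : Odd 167) hπ hκ
  set H' : Matrix ι ι ℤ := Matrix.of fun i j => s i * t j * H i j with hH'def
  have hinv' : ∀ i j, H' (π i) (κ j) = H' i j := fun i j => by
    simp only [hH'def, Matrix.of_apply]; exact hinv i j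
  have hH'ne : ∀ i j, H' i j ≠ 0 := fun i j => pm_ne_zero (hH'.1 i j)
  set d₁ : ι → ℤ := fun i => s (π' i) * s i * d' i with hd₁
  set e₁ : ι → ℤ := fun j => t (κ' j) * t j * e' j with he₁
  have hρ' : IsSignedAut H' π' κ' d₁ e₁ := signedAut_resign' hs ht haut'
  obtain ⟨x₀⟩ : Nonempty ι := Fintype.card_pos_iff.mp (by rw [hι]; norm_num)
  obtain ⟨-, hE⟩ := signs_const_of_normalizing hH'ne hinv' (by decide : Odd 167) hπ hρ' hnπ hnκ x₀
  have hd₁neg : ∀ i, d₁ (π' i) = -d₁ i := fun i => by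
    simp only [hd₁]; rw [hππ, hnegd]; ring
  have he₁neg : ∀ j, e₁ (κ' j) = -e₁ j := fun j => by
    simp only [he₁]; rw [hκκ, hnege]; ring
  -- transversals of rows and of columns
  have htr : ∀ ρ : Equiv.Perm ι, ρ ^ 167 = 1 → (∀ x, ρ x ≠ x) →
      ∃ T : Finset ι, T.card = 4 ∧
        ∀ f : ι → ℤ, ∑ y ∈ (univ : Finset ι), f y = ∑ u ∈ T, ∑ k ∈ Finset.range 167, f ((ρ ^ k) u) := by
    intro ρ hρ hfix
    have hfree : ∀ y ∈ (univ : Finset ι), ∀ k, 0 < k → k < 167 → (ρ ^ k) y ≠ y :=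
      fun y _ => free_of_fixed_prime_pow ρ p167 (by rw [hρ, Equiv.Perm.one_apply]) (hfix y)
    obtain ⟨T, -, hTc, hTs⟩ := exists_free_transversal ρ (by norm_num : 0 < 167) _ univ le_rfl
      (fun y _ => Finset.mem_univ _) (fun y _ => by rw [hρ, Equiv.Perm.one_apply]) hfree
    rw [Finset.card_univ, hι] at hTc
    exact ⟨T, by omega, hTs⟩
  obtain ⟨TR, hTR4, hTRs⟩ := htr π hπ hπfix
  obtain ⟨TC, hTC4, hTCs⟩ := htr κ hκ hκfix
  let eR4 : Fin 4 ≃ {u // u ∈ TR} := (Finset.equivFinOfCardEq hTR4).symm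
  let eC4 : Fin 4 ≃ {u // u ∈ TC} := (Finset.equivFinOfCardEq hTC4).symm
  have hbR0 := orbitMap_bijective π hι TR hTRs eR4
  have hbC0 := orbitMap_bijective κ hι TC hTCs eC4
  -- paired base points
  obtain ⟨τf, bR, mR, hτne, hττ, hbRm, hbRpair⟩ :=
    exists_paired_reps hπ hnπ (fun p => (eR4 p).1) hbR0 hππ hrout
  obtain ⟨τg, bC, mC, hτne', hττ', hbCm, hbCpair⟩ :=
    exists_paired_reps (π := κ) (π' := κ') hκ hnκ (fun q => (eC4 q).1) hbC0 hκκ hcout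
  -- orbit bijections based at the paired base points (gen 20's shift argument)
  let fR : Fin 4 × ZMod 167 → ι := fun a => (π ^ a.2.val) (bR a.1)
  let fC : Fin 4 × ZMod 167 → ι := fun a => (κ ^ a.2.val) (bC a.1)
  have hfR : ∀ a : Fin 4 × ZMod 167,
      fR a = (fun a : Fin 4 × ZMod 167 => (π ^ a.2.val) (eR4 a.1).1) (a.1, a.2 + (mR a.1 : ZMod 167)) := by
    intro a
    show (π ^ a.2.val) (bR a.1) = (π ^ (a.2 + (mR a.1 : ZMod 167)).val) (eR4 a.1).1
    rw [hbRm a.1, ← Equiv.Perm.mul_apply, ← pow_add]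
    congr 1
    apply pow_eq_pow_of_natCast_eq_n hπ
    rw [ZMod.natCast_zmod_val]; push_cast; rw [ZMod.natCast_zmod_val]
  have hfC : ∀ a : Fin 4 × ZMod 167,
      fC a = (fun a : Fin 4 × ZMod 167 => (κ ^ a.2.val) (eC4 a.1).1) (a.1, a.2 + (mC a.1 : ZMod 167)) := by
    intro a
    show (κ ^ a.2.val) (bC a.1) = (κ ^ (a.2 + (mC a.1 : ZMod 167)).val) (eC4 a.1).1
    rw [hbCm a.1, ← Equiv.Perm.mul_apply, ← pow_add]
    congr 1
    apply pow_eq_pow_of_natCast_eq_n hκ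
    rw [ZMod.natCast_zmod_val]; push_cast; rw [ZMod.natCast_zmod_val]
  have shiftBij : ∀ (m : Fin 4 → ℕ), Function.Bijective (fun a : Fin 4 × ZMod 167 => (a.1, a.2 + (m a.1 : ZMod 167))) := by
    intro m
    refine (Equiv.mk (fun a : Fin 4 × ZMod 167 => (a.1, a.2 + (m a.1 : ZMod 167)))
      (fun a => (a.1, a.2 - (m a.1 : ZMod 167))) (fun a => ?_) (fun a => ?_)).bijective
    · simp
    · simp
  have hbR : Function.Bijective fR := by
    have : fR = (fun a : Fin 4 × ZMod 167 => (π ^ a.2.val) (eR4 a.1).1) ∘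
        (fun a : Fin 4 × ZMod 167 => (a.1, a.2 + (mR a.1 : ZMod 167))) := funext fun a => hfR a
    rw [this]; exact hbR0.comp (shiftBij mR)
  have hbC : Function.Bijective fC := by
    have : fC = (fun a : Fin 4 × ZMod 167 => (κ ^ a.2.val) (eC4 a.1).1) ∘
        (fun a : Fin 4 × ZMod 167 => (a.1, a.2 + (mC a.1 : ZMod 167))) := funext fun a => hfC a
    rw [this]; exact hbC0.comp (shiftBij mC)
  let ER : Fin 4 × ZMod 167 ≃ ι := Equiv.ofBijective fR hbR
  let EC : Fin 4 × ZMod 167 ≃ ι := Equiv.ofBijective fC hbC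
  -- the involutions of `Fin 4`
  have hτf_inv : Function.Involutive τf := hττ
  have hτg_inv : Function.Involutive τg := hττ'
  refine ⟨hτf_inv.toPerm _, hτg_inv.toPerm _, fun p => d₁ (bR p), fun q => e₁ (bC q),
    fun p q r => H' (bR p) ((κ ^ r.val) (bC q)), hτne, hττ, hτne', hττ', fun p => hρ'.1 _, fun q => hρ'.2.1 _,
    fun p => ?_, fun q => ?_, fun p q r => ?_, ?_⟩
  · show d₁ (bR (τf p)) = -d₁ (bR p)
    rw [← hbRpair, hd₁neg]
  · show e₁ (bC (τg q)) = -e₁ (bC q)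
    rw [← hbCpair, he₁neg]
  · -- the pairing relation from `ρ'`
    show H' (bR (τf p)) ((κ ^ (-r).val) (bC (τg q))) = d₁ (bR p) * e₁ (bC q) * H' (bR p) ((κ ^ r.val) (bC q))
    have hμ' : (μ : ZMod 167) = -1 := by
      rw [← ZMod.natCast_mod μ 167, hμ]; exact zmod167_166
    have h1 := hρ'.2.2 (bR p) ((κ ^ r.val) (bC q))
    have hE' : e₁ ((κ ^ r.val) (bC q)) = e₁ (bC q) := hE r.val (bC q)
    have e1 : κ ^ (μ * r.val) = κ ^ (-r).val := by
      apply pow_eq_pow_of_natCast_eq_n hκ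
      rw [ZMod.natCast_zmod_val]; push_cast; rw [ZMod.natCast_zmod_val, hμ']; ring
    rw [hbRpair, norm_apply_pow hnκ r.val (bC q), hbCpair, e1] at h1
    rw [h1, hE']
  · -- the array is the reindexed H'
    have hentry : ∀ a b : Fin 4 × ZMod 167,
        H' (bR a.1) ((κ ^ (b.2 - a.2).val) (bC b.1)) = H' (ER a) (EC b) := by
      intro a b
      show H' (bR a.1) ((κ ^ (b.2 - a.2).val) (bC b.1)) = H' ((π ^ a.2.val) (bR a.1)) ((κ ^ b.2.val) (bC b.1))
      have e1 : (κ ^ b.2.val) (bC b.1) = (κ ^ a.2.val) ((κ ^ (b.2 - a.2).val) (bC b.1)) := by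
        rw [← Equiv.Perm.mul_apply, ← pow_add, ← pow_mod_of_pow_eq_one κ hκ (a.2.val + (b.2 - a.2).val), ← ZMod.val_add,
          add_sub_cancel]
      rw [e1, perm_aut_pow hinv' a.2.val]
    have hM : (Matrix.of fun (a b : Fin 4 × ZMod 167) => H' (bR a.1) ((κ ^ (b.2 - a.2).val) (bC b.1))) =
        H'.submatrix ER EC := by
      ext a b
      rw [Matrix.of_apply, Matrix.submatrix_apply, hentry]
    rw [hM]
    refine ⟨fun a b => hH'.1 _ _, ?_⟩
    rw [Matrix.transpose_submatrix, Matrix.submatrix_mul_equiv, hH'.2]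
    ext a b
    rw [Matrix.submatrix_apply, Matrix.smul_apply, Matrix.one_apply, Matrix.smul_apply, Matrix.one_apply, hι]
    simp only [EmbeddingLike.apply_eq_iff_eq]
    simp [ZMod.card]

end main

/-! ### the converse: a paired circulant array has the orbit-swapping reversal -/

/-- **A paired circulant array carries a fixed-point-free signed automorphism inverting the block shift**:
`ρ₀ : (p, s) ↦ (τ p, −s)` on rows, `(q, t) ↦ (τ' q, −t)` on columns, with the block signs `ε, ε'`. -/
theorem pairedCirculantArray_inverting_aut (τ τ' : Equiv.Perm (Fin 4)) (ε ε' : Fin 4 → ℤ) (x : Fin 4 → Fin 4 → ZMod 167 → ℤ)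
    (hτ : ∀ p, τ p ≠ p) (hε : ∀ p, ε p = 1 ∨ ε p = -1) (hε' : ∀ q, ε' q = 1 ∨ ε' q = -1)
    (hx : ∀ p q r, x (τ p) (τ' q) (-r) = ε p * ε' q * x p q r) :
    IsSignedAut (Matrix.of fun (a b : Fin 4 × ZMod 167) => x a.1 b.1 (b.2 - a.2))
        (Equiv.prodCongr τ (Equiv.neg (ZMod 167))) (Equiv.prodCongr τ' (Equiv.neg (ZMod 167)))
        (fun a => ε a.1) (fun b => ε' b.1) ∧
      (Equiv.prodCongr τ (Equiv.neg (ZMod 167)) : Equiv.Perm (Fin 4 × ZMod 167)) *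
          Equiv.prodCongr (Equiv.refl (Fin 4)) (Equiv.addRight (1 : ZMod 167)) =
        (Equiv.prodCongr (Equiv.refl (Fin 4)) (Equiv.addRight (1 : ZMod 167))) ^ 166 *
          Equiv.prodCongr τ (Equiv.neg (ZMod 167)) ∧
      (Equiv.prodCongr τ' (Equiv.neg (ZMod 167)) : Equiv.Perm (Fin 4 × ZMod 167)) *
          Equiv.prodCongr (Equiv.refl (Fin 4)) (Equiv.addRight (1 : ZMod 167)) =
        (Equiv.prodCongr (Equiv.refl (Fin 4)) (Equiv.addRight (1 : ZMod 167))) ^ 166 *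
          Equiv.prodCongr τ' (Equiv.neg (ZMod 167)) ∧
      ∀ a : Fin 4 × ZMod 167, (Equiv.prodCongr τ (Equiv.neg (ZMod 167))) a ≠ a := by
  set σ₀ : Equiv.Perm (Fin 4 × ZMod 167) := Equiv.prodCongr (Equiv.refl (Fin 4)) (Equiv.addRight (1 : ZMod 167)) with hσ₀
  have hσapp : ∀ k : ℕ, ∀ a : Fin 4 × ZMod 167, (σ₀ ^ k) a = (a.1, a.2 + k) := by
    intro k
    induction k with
    | zero => intro a; simp
    | succ k ih =>
      intro a
      rw [pow_succ', Equiv.Perm.mul_apply, ih]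
      simp only [hσ₀, Equiv.prodCongr_apply, Equiv.coe_refl, Prod.map_apply, id_eq, Equiv.coe_addRight]
      push_cast
      rw [add_assoc]
  have hσ1 : ∀ a : Fin 4 × ZMod 167, σ₀ a = (a.1, a.2 + 1) := fun ⟨p, s⟩ => rfl
  have hρapp : ∀ (θ : Equiv.Perm (Fin 4)) (a : Fin 4 × ZMod 167), (Equiv.prodCongr θ (Equiv.neg (ZMod 167))) a = (θ a.1, -a.2) :=
    fun θ ⟨p, s⟩ => rfl
  have hrel : ∀ θ : Equiv.Perm (Fin 4), (Equiv.prodCongr θ (Equiv.neg (ZMod 167)) : Equiv.Perm (Fin 4 × ZMod 167)) * σ₀ =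
      σ₀ ^ 166 * Equiv.prodCongr θ (Equiv.neg (ZMod 167)) := by
    intro θ
    apply Equiv.ext
    intro a
    rw [Equiv.Perm.mul_apply, Equiv.Perm.mul_apply, hσ1, hρapp, hρapp, hσapp]
    refine Prod.ext rfl ?_
    show -(a.2 + 1) = -a.2 + ((166 : ℕ) : ZMod 167)
    rw [zmod167_166]; ring
  refine ⟨⟨fun a => hε a.1, fun b => hε' b.1, fun a b => ?_⟩, hrel τ, hrel τ', fun a h => hτ a.1 ?_⟩
  · rw [Matrix.of_apply, Matrix.of_apply, hρapp, hρapp]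
    show x (τ a.1) (τ' b.1) (-b.2 - -a.2) = ε a.1 * ε' b.1 * x a.1 b.1 (b.2 - a.2)
    rw [show -b.2 - -a.2 = -(b.2 - a.2) by ring, hx]
  · have h1 := congrArg Prod.fst h
    rw [hρapp] at h1
    exact h1

/-- **The dictionary (fixed-point-free inversion at order 167).**  For every `μ ≡ 166 (mod 167)`: *some Hadamard matrix of
order `668` has an element `σ` of pair exponent `167`, non-trivial, and a signed automorphism inverting it (multiplier `μ`)
that fixes NO row* **iff** *some Hadamard matrix of order `668` is a `4 × 4` array of circulant `±1` blocks of order `167` paired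
under transposition: `x (τ p) (τ' q) (−r) = ε p · ε' q · x p q r` for fixed-point-free involutions `τ, τ'` of `Fin 4` and signs
with `ε ∘ τ = −ε`, `ε' ∘ τ' = −ε'`.* -/
theorem hadamard668_aut167_inverting_fpf_iff_pairedCirculantArray (μ : ℕ) (hμ : μ % 167 = 166) :
    (∃ (ι : Type) (_ : Fintype ι) (_ : DecidableEq ι) (H : Matrix ι ι ℤ) (π κ π' κ' : Equiv.Perm ι)
        (d e d' e' : ι → ℤ),
        Fintype.card ι = 668 ∧ IsHadamardMatrix H ∧ IsSignedAut H π κ d e ∧ π ^ 167 = 1 ∧ κ ^ 167 = 1 ∧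
        (π ≠ 1 ∨ κ ≠ 1) ∧ IsSignedAut H π' κ' d' e' ∧ π' * π = π ^ μ * π' ∧ κ' * κ = κ ^ μ * κ' ∧ ∀ x, π' x ≠ x) ↔
    ∃ (τ τ' : Equiv.Perm (Fin 4)) (ε ε' : Fin 4 → ℤ) (x : Fin 4 → Fin 4 → ZMod 167 → ℤ),
      (∀ p, τ p ≠ p) ∧ (∀ p, τ (τ p) = p) ∧ (∀ q, τ' q ≠ q) ∧ (∀ q, τ' (τ' q) = q) ∧
      (∀ p, ε p = 1 ∨ ε p = -1) ∧ (∀ q, ε' q = 1 ∨ ε' q = -1) ∧ (∀ p, ε (τ p) = -ε p) ∧ (∀ q, ε' (τ' q) = -ε' q) ∧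
      (∀ p q r, x (τ p) (τ' q) (-r) = ε p * ε' q * x p q r) ∧
      IsHadamardMatrix (Matrix.of fun (a b : Fin 4 × ZMod 167) => x a.1 b.1 (b.2 - a.2)) := by
  constructor
  · rintro ⟨ι, _, _, H, π, κ, π', κ', d, e, d', e', hι, hH, haut, hπ, hκ, hne, haut', hnπ, hnκ, hfpf⟩
    exact exists_pairedCirculantArray_of_inverting_fpf hH hι haut hπ hκ hne haut' hnπ hnκ hμ hfpf
  · rintro ⟨τ, τ', ε, ε', x, hτ, hττ, hτ', hττ', hε, hε', hετ, hετ', hx, hM⟩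
    obtain ⟨hautσ, hcard, hord⟩ := hadamard668_circulantArray_aut167 x hM
    obtain ⟨hautρ, hrel, hrel', hmove⟩ := pairedCirculantArray_inverting_aut τ τ' ε ε' x hτ hε hε' hx
    set σ₀ : Equiv.Perm (Fin 4 × ZMod 167) := Equiv.prodCongr (Equiv.refl (Fin 4)) (Equiv.addRight (1 : ZMod 167)) with hσ₀
    have h167 : σ₀ ^ 167 = 1 := by
      have h := pow_orderOf_eq_one ((σ₀, σ₀) : Equiv.Perm (Fin 4 × ZMod 167) × Equiv.Perm (Fin 4 × ZMod 167))
      rw [hord, Prod.pow_mk, Prod.mk_eq_one] at h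
      exact h.1
    have hne : σ₀ ≠ 1 := by
      intro h1
      have h2 := congrArg (fun ρ : Equiv.Perm (Fin 4 × ZMod 167) => (ρ ((0 : Fin 4), (0 : ZMod 167))).2) h1
      have h3 : ((0 : ZMod 167) + 1) = 0 := h2
      exact absurd h3 (by decide)
    have hpow : σ₀ ^ μ = σ₀ ^ 166 := by
      rw [← pow_mod_of_pow_eq_one σ₀ h167 μ, hμ]
    refine ⟨Fin 4 × ZMod 167, inferInstance, inferInstance, _, σ₀, σ₀, _, _, _, _, _, _, hcard, hM, hautσ, h167, h167,
      Or.inl hne, hautρ, ?_, ?_, hmove⟩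
    · rw [hpow]; exact hrel
    · rw [hpow]; exact hrel'

end Summit.Ventures.DiscreteObjects.Hadamard
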